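import Summits.BirchSwinnertonDyer.Rank1Residual.ManinAdditive.QuarterShiftTwistUFamily
import Mathlib.Algebra.IsPrimePow
import HarnessLib
import HarnessLib.Audit.Tags

/-!
# The `u`-family PRIMALITY REPAIR: E-es-163/164 are false off the prime sub-family; repaired rows E-es-163R/164R,
# the composite cusp-zero law E-es-167, and the typed refutation shape (cell `bsd-f2-manin`, es g35, MEMO-es §56)

MATHEMATICS (es g35; census HOME/es/g35/UFAMILY-ALLU-CENSUS-v1.tsv sha16 066700b328813ea9: ALL odd `u` with
`N(E_u) = 2^{f₂}·rad(u²+4) ≤ 5·10⁵`, 330 members / 326 isogeny classes, 0 unmatched).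

* `E_u : y² = (x+u)(x²+4)` (`= [0,u,0,4,4u]`, `Δ = −2⁸(u²+4)²`, Kodaira IV* resp. I₀* at 2) and `E'_u = E_u/⟨T⟩ : y² = x³+ux²−x`
  (`Δ = 2⁴(u²+4)`).  The tree rows E-es-163 `UFamilyCuspidalImageNonzeroAtConductorFour` / E-es-164 `…AtConductorSixteen`
  quantify over EVERY `u ≡ 1` resp. `3 (mod 4)` — they carry NEITHER an's lattice-optimality binder (E-an-150) NOR the
  primality of `u²+4` (imc E-imc-28/82, an E-an-74) — and `CuspidalImageNonzero D.f` depends only on the newform of the CLASS.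
* CENSUS FACTS (exhaustive below `5·10⁵`): (i) `u²+4` prime (86 members: 55 at `4 ∥ N`, 31 at `16 ∥ N`): the `X₀`-optimal curve
  is `E_u` (86/86), `deg φ` odd 55/55 at `4 ∥ N`, `v₂(deg) = 2` 31/31 at `16 ∥ N`, NONFLAT 17/17 (`N ≤ 5000`); (ii) `u²+4` NOT prime
  (244 members): the optimal curve is `E'_u` (242/244; the two others are the aliases `u = ∓11 ↦` classes 20a/80b of `u = ±1`,
  `125 = 5³`), `deg φ` EVEN 242/242, and among the 15 such classes with `N ≤ 5000`: `ψ(0) = O` 15/15, **FLAT 6/15**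
  (`𝓛̄_f = Λ_f`: 1220a1 `u = −39`, 1780a1 `u = 21`, 1780b1 `u = −199`, 2180a1 `u = 261`, 2980b1 `u = 61` at `4 ∥ N`; 4880e1 `u = 39`
  at `16 ∥ N`; CUSPIMG-N5000: every cusp maps to `O`), NONFLAT 9/15 via `ψ(1/q) = T'` at the single-odd-prime cusps.
* CONSEQUENCE: **E-es-163 and E-es-164 are FALSE as typed** (class `misstated`), granted modularity of the witnesses
  (`exists_isNewformOf` gives a datum `D` for the minimal model of `E_{−39}` at its conductor `1220`; `D.f` = newform 1220a, FLAT).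
  The kernel cannot construct `D`, so the refutation is BY TABLE; its logical shape is `not_uFamilyCuspidalImageNonzeroAtConductorFour_of_flat`
  below (flat witness ⟹ ¬E-163), with the table fact isolated as the `Prop` `UFamilyFlatWitnessAtFour` (certified numerics, -data engines).
* REPAIR: add `Nat.Prime (u²+4)` — rows **E-es-163R `UFamilyCuspidalImageNonzeroAtFourP`**, **E-es-164R `…AtSixteenP`** (BC5: 55/55 +
  31/31 `ψ(0)₂ = T` PSIC0-BLIND89-v1; FAMILY-BEYOND-v1 21/21 `ψ(0) = T` for `5·10⁵ < N ≤ 980116`; in range they are the cusp face of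
  an's E-an-74/E-imc-28 (odd optimal degree at `4p`) via an's THEOREM C `FourPCuspZeroParity`, and of Yazdani's printed expectation
  E-imc-82 `FourPFamilyCongruenceOdd` [Yazdani 2011, ANT 5(1) Thm 3.8 + p. 15]); the quarter-shift transport (THEOREM 55.A, landed
  `uFamilyCuspidalImageNonzero_four_iff_sixteen_of_modularity`) carries over verbatim: `uFamilyCuspidalImageNonzeroAtSixteenP_of`,
  `uFamilyCuspidalImageNonzeroAtFourP_of` below (S-es-g34-1/1′ as hypotheses; both are THEOREMS mod `exists_isNewformOf`, p2 g19).
* NEW LAW **E-es-167 `UFamilyCompositeCuspZero`** (es lens: an L-VALUE INTEGRALITY law): off the prime-power sub-family the central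
  symbol is a PERIOD, `{∞,0}_f ∈ Λ_f` (`ψ(0) = O`, i.e. `L(f_u,1) ∈ ℤ·Ω₁(f)`), BC5 15/15 (`N ≤ 5000`); BSD-shape mechanism: the optimal
  curve `E'_u` has `Δ > 0` (two real components, `Ω_BSD = 2Ω₁`), `E'_u(ℚ)_tors ⊇ ℤ/2`, odd Tamagawa numbers at the `I₁`/non-split primes,
  so `L/Ω_BSD ∈ ½ℤ` forces `L(f,1) ∈ ℤΩ₁`.  Why it might fail: a composite member with `ψ(0) = T'` beyond `N = 5000` (229 classes untested).
Nothing here proves BSD, Manin's conjecture or C2; E-es-163R/164R/167 are LAWS (cell candidates, NOTHING ASSERTED).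

TYPER NOTE (typer g21, T-es-66).  SOURCE = HOME/es/g35/UFamilyPrimality-es-g35.lean sha16 140e5d4a191c637a (185 l.; es: farm rc 0·0·0·0,
std axioms, BC7 3/3 CLEAN; MEMO-es §56, HOME/es/g35/MEMO-es-sec56.md; censuses UFAMILY-ALLU-CENSUS-v1.tsv 066700b328813ea9, CUSPIMG-N5000,
FAMILY-BEYOND-v1) VERBATIM but for two gate-lint docstrings (`uFamilyCuspidalImageNonzeroAtSixteenP_of_atConductorSixteen`, `natAbs_neg_sq_add_four`, the latter's `private` dropped) and this note.  Imports: landed `…ManinAdditive.QuarterShiftTwistUFamily` (p742203) +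
`Mathlib.Algebra.IsPrimePow` + HarnessLib(+Audit.Tags) — route-independent; flat namespace `…Rank1Residual.ManinAdditive`.  STATUS OF THE OLD
ROWS: **E-es-163 `UFamilyCuspidalImageNonzeroAtConductorFour` and E-es-164 `…AtConductorSixteen` (landed in `QuarterShiftTwistUFamily.lean`,
p742203) are declared FALSE AS TYPED by their author** (class misstated: no primality of `u²+4`, no lattice-optimality; census witnesses 1220a1,
1780a1, 1780b1, 2180a1, 2980b1 / 4880e1 FLAT); their bodies stay (immutable) and the refutation is typed here BY SHAPE
(`not_uFamilyCuspidalImageNonzeroAtConductorFour_of_flat : UFamilyFlatWitnessAtFour → ¬ E-es-163`, `…Sixteen_of_flat`,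
`…Sixteen_of_flat_four`) with the table facts isolated as the `@[conjecture]` witness rows `UFamilyFlatWitnessAtFour/AtSixteen` (certified
numerics, not kernel); a «⚠ REFUTED AS TYPED» docstring fold on the old rows is OWED with the next substantive append to that file (the gate
refuses docstring-only resubmissions).  NEW ROWS (es's `@[conjecture]` tags, nothing asserted): **E-es-163R `UFamilyCuspidalImageNonzeroAtFourP`**,
**E-es-164R `UFamilyCuspidalImageNonzeroAtSixteenP`** (+ `Nat.Prime (u²+4).natAbs`; 55/55 + 31/31 + 21/21 beyond range), **E-es-167
`UFamilyCompositeCuspZero`** (¬IsPrimePow (u²+4) → {∞,0}_f ∈ Λ_f; 15/15); PROVED glue `uFamilyCuspidalImageNonzeroAtFourP_of_atConductorFour`,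
`…AtSixteenP_of_atConductorSixteen`, `uFamilyCuspidalImageNonzeroAtSixteenP_of`, `uFamilyCuspidalImageNonzeroAtFourP_of`,
`uFamilyCuspidalImageNonzero_fourP_iff_sixteenP`.  REFUTER: ref1 R-es-82 PENDING at landing.  14 decl names fresh; no instances, no notation,
no sorry.  `--supports` refused for ManinAdditive ⇒ bears_on: stmt-BirchSwinnertonDyer-22967 (C2 `ManinOddAtFour`).  BSD is not proved by this;
C2 OPEN.
-/

noncomputable section

open scoped MatrixGroups ModularForm

open CongruenceSubgroup WeierstrassCurve
  Literature.NumberTheory.DiophantineGeometry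
  Literature.NumberTheory.EllipticCurves
  Literature.NumberTheory.EllipticCurves.ModularForms

namespace Summit.BirchSwinnertonDyer.Rank1Residual.ManinAdditive

section UFamilyPrimality

/-- **E-es-163R `UFamilyCuspidalImageNonzeroAtFourP`** (LAW; E-es-163 repaired by the primality binder): for a `u`-family curve
with `u ≡ 1 (mod 4)` and `u² + 4` PRIME (`N = 4p`), some cusp of `X₀(N)` maps to a non-zero point (`ψ(0) = T` observed).
BC5: PSIC0-BLIND89-v1 55/55; FAMILY-BEYOND-v1 21/21 beyond `5·10⁵`.  Why it might fail: a flat prime member beyond the tables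
(it would have even optimal degree, killing E-an-74/E-imc-28 and Yazdani's expectation E-imc-82 with it). -/
@[conjecture]
def UFamilyCuspidalImageNonzeroAtFourP : Prop :=
  ∀ (W : WeierstrassCurve ℚ) [W.IsElliptic] [W.IsGloballyMinimal] [NeZero (W.conductorNorm ℤ)]
    (D : ModularParametrizationData W (W.conductorNorm ℤ)) (u : ℤ),
    IsUFamilyCurve W u → u % 4 = 1 → Nat.Prime (Int.natAbs (u ^ 2 + 4)) → QiCuspPincer.CuspidalImageNonzero D.f

/-- **E-es-164R `UFamilyCuspidalImageNonzeroAtSixteenP`** (LAW; E-es-164 repaired): `u ≡ 3 (mod 4)`, `u² + 4` prime, `16 ∥ N`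
⟹ `ψ(C₀) ≠ 0`.  BC5: 31/31.  Why it might fail: as E-es-163R (one statement along the `χ₋₄` pair, glue below). -/
@[conjecture]
def UFamilyCuspidalImageNonzeroAtSixteenP : Prop :=
  ∀ (W' : WeierstrassCurve ℚ) [W'.IsElliptic] [W'.IsGloballyMinimal] [NeZero (W'.conductorNorm ℤ)]
    (D' : ModularParametrizationData W' (W'.conductorNorm ℤ)) (u : ℤ),
    IsUFamilyCurve W' u → u % 4 = 3 → Nat.Prime (Int.natAbs (u ^ 2 + 4)) →
    2 ^ 4 ∣ W'.conductorNorm ℤ → ¬ 2 ^ 5 ∣ W'.conductorNorm ℤ →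
    QiCuspPincer.CuspidalImageNonzero D'.f

/-- The misstated row implies its repair (drop the primality hypothesis). -/
theorem uFamilyCuspidalImageNonzeroAtFourP_of_atConductorFour (h : UFamilyCuspidalImageNonzeroAtConductorFour) :
    UFamilyCuspidalImageNonzeroAtFourP :=
  fun W _ _ _ D u hU hu _ => h W D u hU hu

/-- The misstated row at `16 ∥ N` implies its repair (drop the primality hypothesis). (Docstring added by the typer: gate lint.) -/
theorem uFamilyCuspidalImageNonzeroAtSixteenP_of_atConductorSixteen (h : UFamilyCuspidalImageNonzeroAtConductorSixteen) :
    UFamilyCuspidalImageNonzeroAtSixteenP :=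
  fun W' _ _ _ D' u hU hu _ h16 h32 => h W' D' u hU hu h16 h32

/-- `|(−u)² + 4| = |u² + 4|`. (Docstring added by the typer: gate lint; `private` dropped — it only hides the name.) -/
theorem natAbs_neg_sq_add_four (u : ℤ) : Int.natAbs ((-u) ^ 2 + 4) = Int.natAbs (u ^ 2 + 4) := by
  rw [neg_sq]

/-- **KERNEL GLUE (THEOREM 55.A on the prime sub-family): E-es-164R ⟸ S-es-g34-1 ∧ E-es-163R.** -/
theorem uFamilyCuspidalImageNonzeroAtSixteenP_of (hT : UFamilyNegOneTwinAtSixteen)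
    (h4 : UFamilyCuspidalImageNonzeroAtFourP) : UFamilyCuspidalImageNonzeroAtSixteenP := by
  intro W' _ _ _ D' u hU hu hp h16 h32
  obtain ⟨W, _, _, _, D, hUW, hN, hiso⟩ := hT W' u hU hu h16 h32
  have hNN' : W.conductorNorm ℤ ∣ W'.conductorNorm ℤ := ⟨4, by rw [hN]; ring⟩
  have h4W : 2 ^ 2 ∣ W.conductorNorm ℤ := by
    have h : 2 ^ 4 ∣ 4 * W.conductorNorm ℤ := hN ▸ h16
    obtain ⟨k, hk⟩ := h
    exact ⟨k, by omega⟩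
  have h4W' : 2 ^ 2 ∣ W'.conductorNorm ℤ := dvd_trans (by norm_num) h16
  have h16' : 4 ^ 2 ∣ W'.conductorNorm ℤ := by norm_num at h16 ⊢; exact h16
  have hu' : (-u) % 4 = 1 := by omega
  have hp' : Nat.Prime (Int.natAbs ((-u) ^ 2 + 4)) := by rwa [natAbs_neg_sq_add_four]
  exact cuspidalImageNonzero_of_negOne_twist_levelRaising D D' hNN' h16' h4W h4W' hiso (h4 W D (-u) hUW hu' hp')

/-- **KERNEL GLUE (converse transport): E-es-163R ⟸ S-es-g34-1′ ∧ E-es-164R** (body = g34's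
`uFamilyCuspidalImageNonzeroAtConductorFour_of` with the primality carried along `(−u)² = u²`). -/
theorem uFamilyCuspidalImageNonzeroAtFourP_of (hT : UFamilyNegOneTwinAtFour)
    (h16 : UFamilyCuspidalImageNonzeroAtSixteenP) : UFamilyCuspidalImageNonzeroAtFourP := by
  intro W _ _ _ D u hU hu hp
  obtain ⟨h4W, h8W, W', _, _, _, D', hUW', hN', hiso⟩ := hT W u hU hu
  have h4 : 4 ∣ W.conductorNorm ℤ := by norm_num at h4W; exact h4W
  have h4W' : 2 ^ 2 ∣ W'.conductorNorm ℤ := by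
    rw [hN']; exact dvd_mul_of_dvd_left (by norm_num) _
  have h16' : 2 ^ 4 ∣ W'.conductorNorm ℤ := by
    obtain ⟨k, hk⟩ := h4W
    rw [hN', hk]
    exact ⟨k, by ring⟩
  have h32' : ¬ 2 ^ 5 ∣ W'.conductorNorm ℤ := by
    rintro ⟨k, hk⟩
    apply h8W
    refine ⟨k, ?_⟩
    rw [hN'] at hk
    norm_num at hk ⊢
    omega
  have hu' : (-u) % 4 = 3 := by omega
  have hp' : Nat.Prime (Int.natAbs ((-u) ^ 2 + 4)) := by rwa [natAbs_neg_sq_add_four]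
  exact (cuspidalImageNonzero_iff_of_negOne_twist_levelRaising D D' hN' h4 h4W h4W' hiso).mpr
    (h16 W' D' (-u) hUW' hu' hp' h16' h32')

/-- Modulo the two fact-shaped pairing rows, E-es-163R and E-es-164R are ONE statement. -/
theorem uFamilyCuspidalImageNonzero_fourP_iff_sixteenP (hT : UFamilyNegOneTwinAtSixteen) (hT' : UFamilyNegOneTwinAtFour) :
    UFamilyCuspidalImageNonzeroAtFourP ↔ UFamilyCuspidalImageNonzeroAtSixteenP :=
  ⟨uFamilyCuspidalImageNonzeroAtSixteenP_of hT, uFamilyCuspidalImageNonzeroAtFourP_of hT'⟩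

/-! ### The refutation shape of E-es-163 / E-es-164 (table witnesses 1220a1, 1780a1, 1780b1, 2180a1, 2980b1 / 4880e1) -/

/-- **TABLE FACT (certified numerics, NOT kernel-constructible; -data CUSPIMG-N5000 + es g35 census) `UFamilyFlatWitnessAtFour`:**
some `u`-family curve with `u ≡ 1 (mod 4)` has a modular parametrisation datum at its conductor whose newform is FLAT
(no cusp leaves `Λ_f`).  Instances: `u = −39` (1220a1), `21` (1780a1), `−199` (1780b1), `261` (2180a1), `61` (2980b1). -/
@[conjecture]
def UFamilyFlatWitnessAtFour : Prop :=
  ∃ (W : WeierstrassCurve ℚ) (_ : W.IsElliptic) (_ : W.IsGloballyMinimal) (_ : NeZero (W.conductorNorm ℤ))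
    (D : ModularParametrizationData W (W.conductorNorm ℤ)) (u : ℤ),
    IsUFamilyCurve W u ∧ u % 4 = 1 ∧ ¬ QiCuspPincer.CuspidalImageNonzero D.f

/-- Same at `16 ∥ N` (`u ≡ 3 (mod 4)`; instance `u = 39`, 4880e1). -/
@[conjecture]
def UFamilyFlatWitnessAtSixteen : Prop :=
  ∃ (W' : WeierstrassCurve ℚ) (_ : W'.IsElliptic) (_ : W'.IsGloballyMinimal) (_ : NeZero (W'.conductorNorm ℤ))
    (D' : ModularParametrizationData W' (W'.conductorNorm ℤ)) (u : ℤ),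
    IsUFamilyCurve W' u ∧ u % 4 = 3 ∧ 2 ^ 4 ∣ W'.conductorNorm ℤ ∧ ¬ 2 ^ 5 ∣ W'.conductorNorm ℤ ∧
    ¬ QiCuspPincer.CuspidalImageNonzero D'.f

/-- **A flat witness refutes E-es-163 as typed** (the kernel half of the refutation-by-table). -/
theorem not_uFamilyCuspidalImageNonzeroAtConductorFour_of_flat (h : UFamilyFlatWitnessAtFour) :
    ¬ UFamilyCuspidalImageNonzeroAtConductorFour := by
  obtain ⟨W, _, _, _, D, u, hU, hu, hflat⟩ := h
  exact fun h163 => hflat (h163 W D u hU hu)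

/-- **A flat witness at `16 ∥ N` refutes E-es-164 as typed.** -/
theorem not_uFamilyCuspidalImageNonzeroAtConductorSixteen_of_flat (h : UFamilyFlatWitnessAtSixteen) :
    ¬ UFamilyCuspidalImageNonzeroAtConductorSixteen := by
  obtain ⟨W', _, _, _, D', u, hU, hu, h16, h32, hflat⟩ := h
  exact fun h164 => hflat (h164 W' D' u hU hu h16 h32)

/-- By the landed transport (THEOREM 55.A, S-es-g34-1′), a flat witness at `4 ∥ N` already refutes E-es-164 too. -/
theorem not_uFamilyCuspidalImageNonzeroAtConductorSixteen_of_flat_four (hT : UFamilyNegOneTwinAtFour)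
    (h : UFamilyFlatWitnessAtFour) : ¬ UFamilyCuspidalImageNonzeroAtConductorSixteen :=
  fun h164 => not_uFamilyCuspidalImageNonzeroAtConductorFour_of_flat h
    (uFamilyCuspidalImageNonzeroAtConductorFour_of hT h164)

/-! ### E-es-167: the composite cusp-zero law (central symbol is a period off the prime-power sub-family) -/

/-- **Candidate E-es-167 `UFamilyCompositeCuspZero`** (LAW, es lens = integrality of the central `L`-value in the optimal real
period): if `u² + 4` is NOT a prime power, the newform of `E_u` has `{∞,0}_f ∈ Λ_f` (`ψ(0) = O`, `L(f_u,1) ∈ ℤ·Ω₁(f)`).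
BC5: 15/15 classes `N ≤ 5000` (CUSPIMG-N5000 cusp `0` order 1: 260a, 340a, 1040d, 1220a, 1360e, 1460a, 1780a, 1780b, 2132b, 2180a,
2516b, 2980b, 3860a, 4660b, 4880e); the prime-power aliases `u = ∓11` (classes 20a/80b, `ψ(0) = T`) are correctly excluded.
Why it might fail: a composite member with `ψ(0) = T'` among the 229 untested classes `5000 < N ≤ 5·10⁵` (D-es-g35-1). -/
@[conjecture]
def UFamilyCompositeCuspZero : Prop :=
  ∀ (W : WeierstrassCurve ℚ) [W.IsElliptic] [NeZero (W.conductorNorm ℤ)]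
    (D : ModularParametrizationData W (W.conductorNorm ℤ)) (u : ℤ),
    IsUFamilyCurve W u → ¬ IsPrimePow (Int.natAbs (u ^ 2 + 4)) → modularSymbol D.f 0 ∈ periodLattice D.f

end UFamilyPrimality

end Summit.BirchSwinnertonDyer.Rank1Residual.ManinAdditive

end
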